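import Literature.AlgebraicGeometry.Motives.HodgeDecompositionIsInternalDischarge
import Literature.AlgebraicGeometry.Motives.HodgeDecompositionProofs
import Literature.NumberTheory.Transcendental.KaehlerHodgeEllipticRepresentativeProofs
import HarnessLib

/-!
# `H^{p,q} ≅ H^{p,q}_{∂̄}(M)` on a compact Kähler manifold holds (discharge of `exists_hodgePQ_equiv_dolbeaultCohomology`)

Trunk **T-KAEHLER** (`AlgebraicGeometry/Motives`). Theorems-only leaf companion of
`HodgeDecomposition.lean` (the named fact
`Literature.AlgebraicGeometry.Motives.exists_hodgePQ_equiv_dolbeaultCohomology`, **hodge.S07**,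
comparison form: on a compact Kähler manifold there is a `ℂ`-linear isomorphism
`e : H^{p,q} ≃ₗ[ℂ] H^{p,q}_{∂̄}(M)` sending the de Rham class of every closed smooth `(p,q)`-form to
its Dolbeault class; C. Voisin, *Hodge Theory and Complex Algebraic Geometry I* (2002), Lemma 6.18
with §6.1.3 Prop. 6.11, PDF pp. 121–122) and of its reduction file `HodgeDecompositionProofs.lean`,
whose `exists_hodgePQ_equiv_dolbeaultCohomology_of_classMap` reduces the fact to three statements
about the class map `α ↦ [α]_{∂̄}` on the closed `(p,q)`-forms of a compact Kähler manifold: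

* (B) a `d`-exact closed `(p,q)`-form is `∂̄`-exact;
* (I) a `∂̄`-exact closed `(p,q)`-form is `d`-exact;
* (S) every Dolbeault class is the class of a `d`-CLOSED `(p,q)`-form.

This file proves (B), (I), (S) — Voisin's proof of Prop. 6.11 / Lemma 6.18 run through the
`∂̄`-harmonic and the `Δ_d`-harmonic representatives — from theorems that are all in the tree:

* Thm. 5.24 (harmonic representatives of Dolbeault classes,
  `exists_isDolbeaultHarmonic_mk_eq_of_regularity_of_compactness`, `KaehlerHodgeEllipticRepresentativeProofs`)
  fed with Warner's Theorems 6.6 / 6.5 for `Δ_∂̄` on `A^{p,q}(M)`, which are THEOREMS of the tree's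
  periodic-elliptic programme (`CL2SmoothForms.pq_compact`, `TorusDolbeaultCompactAll`;
  `CL2SmoothForms.pq_regular`, `TorusDolbeaultRegularityPq`) — exactly as they are fed to the Hodge
  decomposition in `HodgeDecompositionIsInternalDischarge.lean`;
* Thm. 5.23 at a Kähler metric (`Δ_d`-harmonic representatives of de Rham classes,
  `exists_isCHarmonicForm_mk_eq` with Warner's Thm. 6.11 supplied by
  `existsUnique_isHarmonicForm_mk_eq_of_compact_of_dolbeault` from the same two `Δ_∂̄` theorems);
* Thm. 6.7, the Kähler identity `Δ_d = 2Δ_∂̄` (PROVED: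
  `cHodgeLaplacian_eq_two_smul_dolbeaultLaplacian_of_isManifold_complex_of_t2Space`), which makes
  `∂̄`-harmonic and `Δ_d`-harmonic the same notion on `(p,q)`-forms (Cor. 6.10);
* the heart of Prop. 6.11 (`isOfType_of_isCHarmonicForm_of_mk_eq`: the harmonic representative of
  the class of a closed `(p,q)`-form has type `(p,q)`), harmonic ⇒ closed
  (`mextDeriv_eq_zero_of_isCHarmonicForm`), and the two orthogonalities "`∂̄`-exact ⊥ `∂̄`-harmonic"
  (Lemma 5.8: `⟪∂̄β, η⟫ = ⟪β, ∂̄*η⟫ = 0`, `MForm.cl2Inner_dolbeaultBar_left_of_isHermitian`) and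
  "`d`-exact ⊥ `Δ_d`-harmonic" (`cl2Inner_eq_zero_of_isCHarmonicForm_of_mem_cexactSmoothForms`).

The arguments (Voisin, p. 121 "let `ω` be a closed form of type `(p,q)` … `ω = α + Δβ` with `α`
harmonic"; Huybrechts (2005), Cor. 3.2.12): (S) the `∂̄`-harmonic representative `η` of a Dolbeault
class is `Δ_d`-harmonic, hence `d`-closed; (B) if `α` is closed of type `(p,q)` and `d`-exact, its
`∂̄`-harmonic representative `η` (`η - α` `∂̄`-exact) is `Δ_d`-harmonic and
`‖η‖² = ⟪η, η - α⟫ + ⟪η, α⟫ = 0 + 0`, so `η = 0` and `α` is `∂̄`-exact; (I) if `α` is closed of type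
`(p,q)` and `∂̄`-exact, its `Δ_d`-harmonic representative `η` (`η - α` `d`-exact) has type `(p,q)`,
is `∂̄`-harmonic, and `‖η‖² = ⟪η, η - α⟫ + ⟪η, α⟫ = 0 + 0`, so `[α] = [η] = 0`. In degrees
`p + q > dim_ℝ M` all forms vanish (`cform_eq_zero_of_finrank_lt`).

Main results:
* `exists_isOfType_mem_cclosedSmoothForms_mk_eq` (S), `mem_dolbeaultExactForms_of_mem_cexactSmoothForms`
  (B), `mem_cexactSmoothForms_of_mem_dolbeaultExactForms` (I) — for compact Kähler manifolds;
* **`exists_hodgePQ_equiv_dolbeaultCohomology_holds`** — discharge of the named fact (all universes,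
  every finite-dimensional complex model space `E`, every real-`C^∞` manifold `M` charted on `E`; the
  hypotheses "compact complex Kähler" are the binders inside the fact);
* `finrank_hodgePQ_eq_hodgeNumber_holds` — the numerical form `dim_ℂ H^{p,q} = h^{p,q}(M)` with the
  instances as ordinary binders (the tree's `finrank_hodgePQ_eq_hodgeNumber` fed the discharge).

No definition and no named fact is introduced (D-0026).

## References

* C. Voisin, *Hodge Theory and Complex Algebraic Geometry I*, Cambridge Studies in Advanced
  Mathematics 76 (2002), §5.1.3 Lemma 5.8, Cor. 5.13, §5.3.1 Thms. 5.23–5.24, §6.1.2 Thm. 6.7,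
  Cor. 6.10, §6.1.3 Prop. 6.11 (PDF p. 121), Lemma 6.18 (PDF p. 122). [Voisin2002] [VoisinHodgeI2002]
* D. Huybrechts, *Complex Geometry* (2005), Cor. 3.2.12 (PDF p. 154). [Huybrechts2005]
* F. W. Warner, *Foundations of Differentiable Manifolds and Lie Groups*, GTM 94 (1983), Thms. 6.5,
  6.6 (p. 222), 6.8, 6.11. [WarnerGTM94]
-/

noncomputable section

open scoped Manifold ContDiff Topology ComplexConjugate ComplexInnerProductSpace
open Bundle Module Set Finset

namespace Literature.AlgebraicGeometry.Motives

open Literature.Geometry.Kaehler Literature.NumberTheory.Transcendental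

/-! ### §1 `∂̄`-exact forms are `L²`-orthogonal to `∂̄`-harmonic forms (Voisin, Lemma 5.8 / Thm. 5.24) -/

section Hermitian

variable {E : Type*} [NormedAddCommGroup E] [NormedSpace ℂ E] [FiniteDimensional ℂ E]
  {n : ℕ} [Fact (finrank ℝ E = n)]
  {M : Type*} [TopologicalSpace M] [ChartedSpace E M]
  [IsManifold 𝓘(ℂ, E) ω M] [IsManifold 𝓘(ℝ, E) ∞ M]
  [RiemannianBundle (fun x : M ↦ TangentSpace 𝓘(ℝ, E) x)]
  (o : (x : M) → Orientation ℝ (TangentSpace 𝓘(ℝ, E) x) (Fin n)) {m : ℕ}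
  [MeasurableSpace E] [BorelSpace E] [T2Space M] [CompactSpace M]
  [IsContinuousRiemannianBundle E (fun x : M ↦ TangentSpace 𝓘(ℝ, E) x)]
  [IsContMDiffRiemannianBundle 𝓘(ℝ, E) ∞ E (fun x : M ↦ TangentSpace 𝓘(ℝ, E) x)]

/-- **`∂̄`-exact forms are `L²`-orthogonal to `∂̄`-harmonic forms** (compact complex manifold, smooth
Hermitian metric in the instance form `hJ`, `vol_o` smooth): for `x ∈ B^{p,q}_{∂̄}(M)` and `η`
`∂̄`-harmonic of type `(p,q)`, `⟪x, η⟫ = 0`. For `q = 0` there are no exact forms; for `q ≥ 1`,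
`x = ∂̄β` with `β ∈ A^{p,q-1}` (`dolbeaultExactForms_succ_eq_range`) and `∂̄*η = 0` (Cor. 5.13,
`isDolbeaultHarmonic_iff_of_inner_tangentJ`), so `⟪∂̄β, η⟫ = ⟪β, ∂̄*η⟫ = 0` (Lemma 5.8,
`MForm.cl2Inner_dolbeaultBar_left_of_isHermitian`). [cite: Voisin2002, §5.1.3 Lemma 5.8 and Thm. 5.24] -/
theorem cl2Inner_eq_zero_of_mem_dolbeaultExactForms_of_isDolbeaultHarmonic
    (hJ : ∀ (x : M) (v w : TangentSpace 𝓘(ℝ, E) x),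
      inner ℝ (tangentJ E x v) (tangentJ E x w) = inner ℝ v w)
    (ho : IsSmoothForm (riemannianVolumeForm o)) {p q : ℕ} (h : (p + q) + m = n)
    {x η : MForm 𝓘(ℝ, E) M ℂ (p + q)} (hx : x ∈ dolbeaultExactForms E M p q)
    (hη : IsDolbeaultHarmonic o p q h η) : MForm.cl2Inner o x η = 0 := by
  rcases q with - | q
  · have hx0 : x = 0 := by simpa using hx
    rw [hx0, MForm.cl2Inner_zero_left]
  · rw [dolbeaultExactForms_succ_eq_range, LinearMap.mem_range] at hx
    obtain ⟨β, hβ⟩ := hx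
    obtain ⟨hβs, -⟩ := (mem_pqForms_iff _).mp β.2
    change dolbeaultBar (β : MForm 𝓘(ℝ, E) M ℂ (p + q)) = x at hβ
    have h' : (p + q + 1) + m = n := by omega
    have hadj : dolbeaultBarAdjoint o h' η = 0 :=
      ((isDolbeaultHarmonic_iff_of_inner_tangentJ o hJ ho h' hη.1 hη.2.1).1 hη).2
    rw [← hβ, MForm.cl2Inner_dolbeaultBar_left_of_isHermitian o hJ ho h' hβs hη.1, hadj,
      MForm.cl2Inner_zero_right]

end Hermitian

/-! ### §2 (S), (B), (I) at a Kähler metric -/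

section Kaehler

variable {E : Type*} [NormedAddCommGroup E] [NormedSpace ℂ E]
  {M : Type*} [TopologicalSpace M] [ChartedSpace E M]
  [FiniteDimensional ℂ E] [IsManifold 𝓘(ℝ, E) ∞ M] {n : ℕ} [Fact (finrank ℝ E = n)]
  (g : ContMDiffRiemannianMetric 𝓘(ℝ, E) ∞ E (fun x : M ↦ TangentSpace 𝓘(ℝ, E) x))
  (o : (x : M) → Orientation ℝ (TangentSpace 𝓘(ℝ, E) x) (Fin n))
  [IsManifold 𝓘(ℂ, E) ω M] [CompactSpace M] [T2Space M]

omit [CompactSpace M] in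
/-- **Cor. 6.10, one direction: a `∂̄`-harmonic form is `Δ_d`-harmonic at a Kähler metric**
(`Δ_d η = 2Δ_∂̄ η = 0`, Thm. 6.7, the tree's theorem
`cHodgeLaplacian_eq_two_smul_dolbeaultLaplacian_of_isManifold_complex_of_t2Space`).
[cite: Voisin2002, §6.1.2 Thm. 6.7 and Cor. 6.10] -/
theorem isCHarmonicForm_of_isDolbeaultHarmonic_of_isKaehler (hg : g.toRiemannianMetric.IsKaehler)
    {k m p q : ℕ} (h : k + m = n) {η : MForm 𝓘(ℝ, E) M ℂ k} :
    letI : RiemannianBundle (fun x : M ↦ TangentSpace 𝓘(ℝ, E) x) := ⟨g.toRiemannianMetric⟩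
    IsSmoothForm (riemannianVolumeForm o) → IsDolbeaultHarmonic o p q h η → IsCHarmonicForm o h η := by
  letI : RiemannianBundle (fun x : M ↦ TangentSpace 𝓘(ℝ, E) x) := ⟨g.toRiemannianMetric⟩
  haveI : IsContMDiffRiemannianBundle 𝓘(ℝ, E) ∞ E (fun x : M ↦ TangentSpace 𝓘(ℝ, E) x) :=
    ⟨g.inner, g.contMDiff, fun _ _ _ ↦ rfl⟩
  intro ho hη
  have hK : cHodgeLaplacian_eq_two_smul_dolbeaultLaplacian_of_isManifold_complex (k := k) (m := m) g o :=
    cHodgeLaplacian_eq_two_smul_dolbeaultLaplacian_of_isManifold_complex_of_t2Space g o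
  exact ⟨hη.1, by rw [hK hg h hη.1 ho, hη.2.2, smul_zero]⟩

omit [CompactSpace M] in
/-- **Cor. 6.10, other direction: a `Δ_d`-harmonic form of type `(p,q)` is `∂̄`-harmonic at a Kähler
metric** (`2Δ_∂̄ η = Δ_d η = 0`). [cite: Voisin2002, §6.1.2 Thm. 6.7 and Cor. 6.10] -/
theorem isDolbeaultHarmonic_of_isCHarmonicForm_of_isKaehler (hg : g.toRiemannianMetric.IsKaehler)
    {k m p q : ℕ} (h : k + m = n) {η : MForm 𝓘(ℝ, E) M ℂ k} (ht : IsOfType p q η) :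
    letI : RiemannianBundle (fun x : M ↦ TangentSpace 𝓘(ℝ, E) x) := ⟨g.toRiemannianMetric⟩
    IsSmoothForm (riemannianVolumeForm o) → IsCHarmonicForm o h η → IsDolbeaultHarmonic o p q h η := by
  letI : RiemannianBundle (fun x : M ↦ TangentSpace 𝓘(ℝ, E) x) := ⟨g.toRiemannianMetric⟩
  haveI : IsContMDiffRiemannianBundle 𝓘(ℝ, E) ∞ E (fun x : M ↦ TangentSpace 𝓘(ℝ, E) x) :=
    ⟨g.inner, g.contMDiff, fun _ _ _ ↦ rfl⟩
  intro ho hη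
  have hK : cHodgeLaplacian_eq_two_smul_dolbeaultLaplacian_of_isManifold_complex (k := k) (m := m) g o :=
    cHodgeLaplacian_eq_two_smul_dolbeaultLaplacian_of_isManifold_complex_of_t2Space g o
  refine ⟨hη.1, ht, ?_⟩
  have h2 : (2 : ℂ) • dolbeaultLaplacian o k m h η = 0 := by
    rw [← hK hg h hη.1 ho]
    exact hη.2
  have e : dolbeaultLaplacian o k m h η = (2 : ℂ)⁻¹ • ((2 : ℂ) • dolbeaultLaplacian o k m h η) := by
    rw [smul_smul, inv_mul_cancel₀ (two_ne_zero : (2 : ℂ) ≠ 0), one_smul]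
  rw [e, h2, smul_zero]

/-- **(S) at a Kähler metric: every Dolbeault class is the class of a `d`-closed `(p,q)`-form** — its
`∂̄`-harmonic representative (Thm. 5.24, from Warner's 6.6/6.5 for `Δ_∂̄` on `A^{p,q}(M)`, the tree's
`CL2SmoothForms.pq_compact` / `pq_regular`), which is `Δ_d`-harmonic (Cor. 6.10) and therefore closed
(Cor. 5.13). Voisin (2002), Lemma 6.18 (surjectivity of `H^{p,q} → H^q(X, Ω^p)`).
[cite: Voisin2002, §6.1.3 Lemma 6.18] -/
theorem exists_isOfType_mem_cclosedSmoothForms_mk_eq_of_isKaehler (hg : g.toRiemannianMetric.IsKaehler)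
    {p q m : ℕ} (h : (p + q) + m = n) (c : dolbeaultCohomology E M p q) :
    letI : RiemannianBundle (fun x : M ↦ TangentSpace 𝓘(ℝ, E) x) := ⟨g.toRiemannianMetric⟩
    IsSmoothForm (riemannianVolumeForm o) →
      ∃ (α : cclosedSmoothForms E M (p + q)) (_ : IsOfType p q (α : MForm 𝓘(ℝ, E) M ℂ (p + q)))
        (hα : (α : MForm 𝓘(ℝ, E) M ℂ (p + q)) ∈ dolbeaultClosedForms E M p q),
        dolbeaultCohomology.mk E M p q ⟨α, hα⟩ = c := by
  letI : RiemannianBundle (fun x : M ↦ TangentSpace 𝓘(ℝ, E) x) := ⟨g.toRiemannianMetric⟩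
  haveI : IsContMDiffRiemannianBundle 𝓘(ℝ, E) ∞ E (fun x : M ↦ TangentSpace 𝓘(ℝ, E) x) :=
    ⟨g.inner, g.contMDiff, fun _ _ _ ↦ rfl⟩
  haveI : IsContinuousRiemannianBundle E (fun x : M ↦ TangentSpace 𝓘(ℝ, E) x) :=
    ⟨g.inner, g.contMDiff.continuous, fun _ _ _ ↦ rfl⟩
  letI : MeasurableSpace E := borel E
  haveI : BorelSpace E := ⟨rfl⟩
  intro ho
  haveI : Fact (IsSmoothForm (riemannianVolumeForm o)) := ⟨ho⟩
  have hJ : ∀ (x : M) (v w : TangentSpace 𝓘(ℝ, E) x),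
      inner ℝ (tangentJ E x v) (tangentJ E x w) = inner ℝ v w := fun x v w ↦ hg.isHermitian x v w
  obtain ⟨η, hη, hηc⟩ := exists_isDolbeaultHarmonic_mk_eq_of_regularity_of_compactness o hJ h
    (CL2SmoothForms.pq_compact o hJ p q h) (CL2SmoothForms.pq_regular o hJ p q h) c
  have hH : IsCHarmonicForm o h (η : MForm 𝓘(ℝ, E) M ℂ (p + q)) :=
    isCHarmonicForm_of_isDolbeaultHarmonic_of_isKaehler g o hg h ho hη
  have hclosed : (η : MForm 𝓘(ℝ, E) M ℂ (p + q)) ∈ cclosedSmoothForms E M (p + q) :=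
    (mem_cclosedSmoothForms_iff _).2 ⟨hη.1, mextDeriv_eq_zero_of_isCHarmonicForm o ho h hH⟩
  exact ⟨⟨η, hclosed⟩, hη.2.1, η.2, hηc⟩

/-- **(B) at a Kähler metric: a `d`-exact closed `(p,q)`-form is `∂̄`-exact.** Let `η` be the
`∂̄`-harmonic representative of `[α]_{∂̄}` (Thm. 5.24), so that `η - α` is `∂̄`-exact; `η` is
`Δ_d`-harmonic (Cor. 6.10), hence `⟪η, α⟫ = 0` (`α` is `d`-exact) and `⟪η, η - α⟫ = 0` (`η - α` is
`∂̄`-exact, `η` is `∂̄`-harmonic), so `‖η‖² = 0`, `η = 0` and `α = -(η - α)` is `∂̄`-exact. This is the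
step "`[α] = 0 ⇒ [α]_{∂̄} = 0`" of Voisin (2002), proof of Prop. 6.11 / Lemma 6.18 (well-definedness
of `K^{p,q} → H^q(X, Ω^p)`). [cite: Voisin2002, §6.1.3 Prop. 6.11 and Lemma 6.18] -/
theorem mem_dolbeaultExactForms_of_mem_cexactSmoothForms_of_isKaehler
    (hg : g.toRiemannianMetric.IsKaehler) {p q m : ℕ} (h : (p + q) + m = n)
    {α : MForm 𝓘(ℝ, E) M ℂ (p + q)} (hαc : α ∈ cclosedSmoothForms E M (p + q))
    (hαt : IsOfType p q α) (hex : α ∈ cexactSmoothForms E M (p + q)) :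
    letI : RiemannianBundle (fun x : M ↦ TangentSpace 𝓘(ℝ, E) x) := ⟨g.toRiemannianMetric⟩
    IsSmoothForm (riemannianVolumeForm o) → α ∈ dolbeaultExactForms E M p q := by
  letI : RiemannianBundle (fun x : M ↦ TangentSpace 𝓘(ℝ, E) x) := ⟨g.toRiemannianMetric⟩
  haveI : IsContMDiffRiemannianBundle 𝓘(ℝ, E) ∞ E (fun x : M ↦ TangentSpace 𝓘(ℝ, E) x) :=
    ⟨g.inner, g.contMDiff, fun _ _ _ ↦ rfl⟩
  haveI : IsContinuousRiemannianBundle E (fun x : M ↦ TangentSpace 𝓘(ℝ, E) x) :=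
    ⟨g.inner, g.contMDiff.continuous, fun _ _ _ ↦ rfl⟩
  letI : MeasurableSpace E := borel E
  haveI : BorelSpace E := ⟨rfl⟩
  intro ho
  haveI : Fact (IsSmoothForm (riemannianVolumeForm o)) := ⟨ho⟩
  have hJ : ∀ (x : M) (v w : TangentSpace 𝓘(ℝ, E) x),
      inner ℝ (tangentJ E x v) (tangentJ E x w) = inner ℝ v w := fun x v w ↦ hg.isHermitian x v w
  have hαs : IsSmoothForm α := ((mem_cclosedSmoothForms_iff α).1 hαc).1
  have hαd : α ∈ dolbeaultClosedForms E M p q := mem_dolbeaultClosedForms_of_mem_cclosedSmoothForms hαc hαt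
  -- the `∂̄`-harmonic representative of `[α]_∂̄`
  obtain ⟨η, hη, hηc⟩ := exists_isDolbeaultHarmonic_mk_eq_of_regularity_of_compactness o hJ h
    (CL2SmoothForms.pq_compact o hJ p q h) (CL2SmoothForms.pq_regular o hJ p q h)
    (dolbeaultCohomology.mk E M p q ⟨α, hαd⟩)
  have hdiff : (η : MForm 𝓘(ℝ, E) M ℂ (p + q)) - α ∈ dolbeaultExactForms E M p q :=
    (dolbeaultCohomology.mk_eq_mk_iff η ⟨α, hαd⟩).1 hηc
  have hηs : IsSmoothForm (η : MForm 𝓘(ℝ, E) M ℂ (p + q)) := hη.1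
  have hH : IsCHarmonicForm o h (η : MForm 𝓘(ℝ, E) M ℂ (p + q)) :=
    isCHarmonicForm_of_isDolbeaultHarmonic_of_isKaehler g o hg h ho hη
  -- `⟪η, η - α⟫ = 0` and `⟪η, α⟫ = 0`
  have h1 : MForm.cl2Inner o (η : MForm 𝓘(ℝ, E) M ℂ (p + q)) ((η : MForm 𝓘(ℝ, E) M ℂ (p + q)) - α) = 0 := by
    rw [← MForm.cl2Inner_conj_symm,
      cl2Inner_eq_zero_of_mem_dolbeaultExactForms_of_isDolbeaultHarmonic o hJ ho h hdiff hη, map_zero]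
  have h2 : MForm.cl2Inner o (η : MForm 𝓘(ℝ, E) M ℂ (p + q)) α = 0 :=
    cl2Inner_eq_zero_of_isCHarmonicForm_of_mem_cexactSmoothForms o ho h hH hex
  have h0 : MForm.cl2Inner o (η : MForm 𝓘(ℝ, E) M ℂ (p + q)) η = 0 :=
    calc MForm.cl2Inner o (η : MForm 𝓘(ℝ, E) M ℂ (p + q)) η
        = MForm.cl2Inner o (η : MForm 𝓘(ℝ, E) M ℂ (p + q)) (((η : MForm 𝓘(ℝ, E) M ℂ (p + q)) - α) + α) := by
          rw [sub_add_cancel]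
      _ = MForm.cl2Inner o (η : MForm 𝓘(ℝ, E) M ℂ (p + q)) ((η : MForm 𝓘(ℝ, E) M ℂ (p + q)) - α) +
            MForm.cl2Inner o (η : MForm 𝓘(ℝ, E) M ℂ (p + q)) α :=
          MForm.cl2Inner_add_right o ho h hηs (hηs.sub hαs) hαs
      _ = 0 := by rw [h1, h2, add_zero]
  have hη0 : (η : MForm 𝓘(ℝ, E) M ℂ (p + q)) = 0 := eq_zero_of_cl2Inner_self_eq_zero o ho h hηs h0
  rw [hη0, zero_sub] at hdiff
  exact (neg_mem_iff).1 hdiff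

/-- **(I) at a Kähler metric: a `∂̄`-exact closed `(p,q)`-form is `d`-exact.** Let `η` be the
`Δ_d`-harmonic representative of `[α]` (Thm. 5.23 at the Kähler metric: Warner's Thm. 6.11 supplied by
`existsUnique_isHarmonicForm_mk_eq_of_compact_of_dolbeault` from the `Δ_∂̄` theorems), so that `η - α`
is `d`-exact; `η` has type `(p,q)` (the heart of Prop. 6.11, `isOfType_of_isCHarmonicForm_of_mk_eq`) and
is `∂̄`-harmonic (Cor. 6.10), hence `⟪η, η - α⟫ = 0` and `⟪η, α⟫ = 0` (`α` is `∂̄`-exact), so `η = 0`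
and `[α] = [η] = 0`. This is the injectivity of `K^{p,q} → H^q(X, Ω^p)` in Voisin (2002), Lemma 6.18.
[cite: Voisin2002, §6.1.3 Prop. 6.11 and Lemma 6.18] -/
theorem mem_cexactSmoothForms_of_mem_dolbeaultExactForms_of_isKaehler
    (hg : g.toRiemannianMetric.IsKaehler) {p q m : ℕ} (h : (p + q) + m = n)
    {α : MForm 𝓘(ℝ, E) M ℂ (p + q)} (hαc : α ∈ cclosedSmoothForms E M (p + q))
    (hαt : IsOfType p q α) (hdex : α ∈ dolbeaultExactForms E M p q) :
    letI : RiemannianBundle (fun x : M ↦ TangentSpace 𝓘(ℝ, E) x) := ⟨g.toRiemannianMetric⟩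
    IsSmoothForm (riemannianVolumeForm o) → α ∈ cexactSmoothForms E M (p + q) := by
  letI : RiemannianBundle (fun x : M ↦ TangentSpace 𝓘(ℝ, E) x) := ⟨g.toRiemannianMetric⟩
  haveI : IsContMDiffRiemannianBundle 𝓘(ℝ, E) ∞ E (fun x : M ↦ TangentSpace 𝓘(ℝ, E) x) :=
    ⟨g.inner, g.contMDiff, fun _ _ _ ↦ rfl⟩
  haveI : IsContinuousRiemannianBundle E (fun x : M ↦ TangentSpace 𝓘(ℝ, E) x) :=
    ⟨g.inner, g.contMDiff.continuous, fun _ _ _ ↦ rfl⟩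
  letI : MeasurableSpace E := borel E
  haveI : BorelSpace E := ⟨rfl⟩
  intro ho
  haveI : Fact (IsSmoothForm (riemannianVolumeForm o)) := ⟨ho⟩
  have hJ : ∀ (x : M) (v w : TangentSpace 𝓘(ℝ, E) x),
      inner ℝ (tangentJ E x v) (tangentJ E x w) = inner ℝ v w := fun x v w ↦ hg.isHermitian x v w
  have hK : cHodgeLaplacian_eq_two_smul_dolbeaultLaplacian_of_isManifold_complex (k := p + q) (m := m) g o :=
    cHodgeLaplacian_eq_two_smul_dolbeaultLaplacian_of_isManifold_complex_of_t2Space g o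
  have hαs : IsSmoothForm α := ((mem_cclosedSmoothForms_iff α).1 hαc).1
  -- Warner's Theorem 6.11 at the Kähler metric, from the `Δ_∂̄` theorems
  have h11 : existsUnique_isHarmonicForm_mk_eq_of_compact 𝓘(ℝ, E) M o (p + q) m := by
    refine existsUnique_isHarmonicForm_mk_eq_of_compact_of_dolbeault g o hg ?_ ?_ (p + q) m
    · intro _ _ hJ' p' q' m' h' ho'
      letI : RiemannianBundle (fun x : M ↦ TangentSpace 𝓘(ℝ, E) x) := ⟨g.toRiemannianMetric⟩
      haveI : IsContMDiffRiemannianBundle 𝓘(ℝ, E) ∞ E (fun x : M ↦ TangentSpace 𝓘(ℝ, E) x) :=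
        ⟨g.inner, g.contMDiff, fun _ _ _ ↦ rfl⟩
      haveI : Fact (IsSmoothForm (riemannianVolumeForm o)) := ⟨ho'⟩
      exact fun u c hb hΔ ↦ CL2SmoothForms.pq_compact o hJ' p' q' h' u c hb hΔ
    · intro _ _ hJ' p' q' m' h' ho'
      letI : RiemannianBundle (fun x : M ↦ TangentSpace 𝓘(ℝ, E) x) := ⟨g.toRiemannianMetric⟩
      haveI : IsContMDiffRiemannianBundle 𝓘(ℝ, E) ∞ E (fun x : M ↦ TangentSpace 𝓘(ℝ, E) x) :=
        ⟨g.inner, g.contMDiff, fun _ _ _ ↦ rfl⟩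
      haveI : Fact (IsSmoothForm (riemannianVolumeForm o)) := ⟨ho'⟩
      exact fun α' ℓ hw ↦ CL2SmoothForms.pq_regular o hJ' p' q' h' α' ℓ hw
  -- the `Δ_d`-harmonic representative of `[α]`
  obtain ⟨η, hηH, hηc⟩ :=
    exists_isCHarmonicForm_mk_eq o h11 ho h (complexDeRhamCohomology.mk E M (p + q) ⟨α, hαc⟩)
  have hηs : IsSmoothForm (η : MForm 𝓘(ℝ, E) M ℂ (p + q)) := hηH.1
  have hηt : IsOfType p q (η : MForm 𝓘(ℝ, E) M ℂ (p + q)) :=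
    isOfType_of_isCHarmonicForm_of_mk_eq g o hK hg rfl h hαc hαt η.2 hηc ho hηH
  have hηD : IsDolbeaultHarmonic o p q h (η : MForm 𝓘(ℝ, E) M ℂ (p + q)) :=
    isDolbeaultHarmonic_of_isCHarmonicForm_of_isKaehler g o hg h hηt ho hηH
  have hex : (η : MForm 𝓘(ℝ, E) M ℂ (p + q)) - α ∈ cexactSmoothForms E M (p + q) :=
    (complexDeRhamCohomology.mk_eq_mk_iff η ⟨α, hαc⟩).1 hηc
  -- `⟪η, η - α⟫ = 0` and `⟪η, α⟫ = 0`
  have h1 : MForm.cl2Inner o (η : MForm 𝓘(ℝ, E) M ℂ (p + q)) ((η : MForm 𝓘(ℝ, E) M ℂ (p + q)) - α) = 0 :=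
    cl2Inner_eq_zero_of_isCHarmonicForm_of_mem_cexactSmoothForms o ho h hηH hex
  have h2 : MForm.cl2Inner o (η : MForm 𝓘(ℝ, E) M ℂ (p + q)) α = 0 := by
    rw [← MForm.cl2Inner_conj_symm,
      cl2Inner_eq_zero_of_mem_dolbeaultExactForms_of_isDolbeaultHarmonic o hJ ho h hdex hηD, map_zero]
  have h0 : MForm.cl2Inner o (η : MForm 𝓘(ℝ, E) M ℂ (p + q)) η = 0 :=
    calc MForm.cl2Inner o (η : MForm 𝓘(ℝ, E) M ℂ (p + q)) η
        = MForm.cl2Inner o (η : MForm 𝓘(ℝ, E) M ℂ (p + q)) (((η : MForm 𝓘(ℝ, E) M ℂ (p + q)) - α) + α) := by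
          rw [sub_add_cancel]
      _ = MForm.cl2Inner o (η : MForm 𝓘(ℝ, E) M ℂ (p + q)) ((η : MForm 𝓘(ℝ, E) M ℂ (p + q)) - α) +
            MForm.cl2Inner o (η : MForm 𝓘(ℝ, E) M ℂ (p + q)) α :=
          MForm.cl2Inner_add_right o ho h hηs (hηs.sub hαs) hαs
      _ = 0 := by rw [h1, h2, add_zero]
  have hη0 : (η : MForm 𝓘(ℝ, E) M ℂ (p + q)) = 0 := eq_zero_of_cl2Inner_self_eq_zero o ho h hηs h0
  have hη0' : η = 0 := Subtype.ext hη0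
  have hmk : complexDeRhamCohomology.mk E M (p + q) ⟨α, hαc⟩ = 0 := by
    rw [← hηc, hη0', map_zero]
  exact (complexDeRhamCohomology_mk_eq_zero_iff ⟨α, hαc⟩).1 hmk

end Kaehler

/-! ### §3 (S), (B), (I) for compact Kähler manifolds, and the discharge -/

section Discharge

variable {E : Type*} [NormedAddCommGroup E] [NormedSpace ℂ E]
  {M : Type*} [TopologicalSpace M] [ChartedSpace E M] [FiniteDimensional ℂ E]
  [IsManifold 𝓘(ℝ, E) ∞ M]

/-- The Kähler package used by the three statements: a Kähler metric (`IsKaehlerManifold.exists_isKaehler`),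
the complex orientation `x ↦ o₀` and the smoothness of its volume form
(`isSmoothForm_riemannianVolumeForm_of_isContinuousOrientation_holds`). [folklore] -/
private theorem exists_isKaehler_and_isSmoothForm_riemannianVolumeForm [IsManifold 𝓘(ℂ, E) ω M]
    [CompactSpace M] [T2Space M] [IsKaehlerManifold E M] :
    ∃ (g : ContMDiffRiemannianMetric 𝓘(ℝ, E) ∞ E (fun x : M ↦ TangentSpace 𝓘(ℝ, E) x))
      (o : (x : M) → Orientation ℝ (TangentSpace 𝓘(ℝ, E) x) (Fin (finrank ℝ E))),
      g.toRiemannianMetric.IsKaehler ∧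
        letI : RiemannianBundle (fun x : M ↦ TangentSpace 𝓘(ℝ, E) x) := ⟨g.toRiemannianMetric⟩
        haveI : Fact (finrank ℝ E = finrank ℝ E) := ⟨rfl⟩
        IsSmoothForm (riemannianVolumeForm o) := by
  obtain ⟨g, hg⟩ := IsKaehlerManifold.exists_isKaehler (E := E) (M := M)
  haveI : Fact (finrank ℝ E = finrank ℝ E) := ⟨rfl⟩
  let o : (x : M) → Orientation ℝ (TangentSpace 𝓘(ℝ, E) x) (Fin (finrank ℝ E)) :=
    fun _ ↦ (modelBasis E (finrank ℝ E)).orientation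
  refine ⟨g, o, hg, ?_⟩
  letI : RiemannianBundle (fun x : M ↦ TangentSpace 𝓘(ℝ, E) x) := ⟨g.toRiemannianMetric⟩
  haveI : IsContinuousRiemannianBundle E (fun x : M ↦ TangentSpace 𝓘(ℝ, E) x) :=
    ⟨g.inner, g.contMDiff.continuous, fun _ _ _ ↦ rfl⟩
  exact isSmoothForm_riemannianVolumeForm_of_isContinuousOrientation_holds o
    (isContinuousOrientation_const _)

/-- **(S) Every Dolbeault class on a compact Kähler manifold is the Dolbeault class of a `d`-closed
smooth `(p,q)`-form** (Voisin (2002), Lemma 6.18: surjectivity of `H^{p,q} → H^{p,q}_{∂̄} = H^q(X, Ω^p)`;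
in degrees above `dim_ℝ M` every form is `0`). [cite: Voisin2002, §6.1.3 Lemma 6.18] -/
theorem exists_isOfType_mem_cclosedSmoothForms_mk_eq [IsManifold 𝓘(ℂ, E) ω M] [CompactSpace M]
    [T2Space M] [IsKaehlerManifold E M] (p q : ℕ) (c : dolbeaultCohomology E M p q) :
    ∃ (α : cclosedSmoothForms E M (p + q)) (_ : IsOfType p q (α : MForm 𝓘(ℝ, E) M ℂ (p + q)))
      (hα : (α : MForm 𝓘(ℝ, E) M ℂ (p + q)) ∈ dolbeaultClosedForms E M p q),
      dolbeaultCohomology.mk E M p q ⟨α, hα⟩ = c := by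
  haveI : Fact (finrank ℝ E = finrank ℝ E) := ⟨rfl⟩
  by_cases hk : finrank ℝ E < p + q
  · obtain ⟨γ, rfl⟩ := dolbeaultCohomology.mk_surjective c
    have hγ0 : (γ : MForm 𝓘(ℝ, E) M ℂ (p + q)) = 0 := cform_eq_zero_of_finrank_lt hk _
    have h0c : (0 : MForm 𝓘(ℝ, E) M ℂ (p + q)) ∈ cclosedSmoothForms E M (p + q) := Submodule.zero_mem _
    refine ⟨⟨0, h0c⟩, isOfType_zero rfl, Submodule.zero_mem _, ?_⟩
    congr 1
    exact Subtype.ext hγ0.symm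
  · obtain ⟨m, hm⟩ : ∃ m, (p + q) + m = finrank ℝ E := ⟨finrank ℝ E - (p + q), by omega⟩
    obtain ⟨g, o, hg, ho⟩ := exists_isKaehler_and_isSmoothForm_riemannianVolumeForm (E := E) (M := M)
    exact exists_isOfType_mem_cclosedSmoothForms_mk_eq_of_isKaehler g o hg hm c ho

/-- **(B) On a compact Kähler manifold a `d`-exact closed `(p,q)`-form is `∂̄`-exact** (Voisin (2002),
proof of Prop. 6.11 / Lemma 6.18: the class map `K^{p,q} → H^q(X, Ω^p)` is well defined).
[cite: Voisin2002, §6.1.3 Prop. 6.11 and Lemma 6.18] -/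
theorem mem_dolbeaultExactForms_of_mem_cexactSmoothForms [IsManifold 𝓘(ℂ, E) ω M] [CompactSpace M]
    [T2Space M] [IsKaehlerManifold E M] (p q : ℕ) (α : MForm 𝓘(ℝ, E) M ℂ (p + q))
    (hαc : α ∈ cclosedSmoothForms E M (p + q)) (hαt : IsOfType p q α)
    (hex : α ∈ cexactSmoothForms E M (p + q)) : α ∈ dolbeaultExactForms E M p q := by
  haveI : Fact (finrank ℝ E = finrank ℝ E) := ⟨rfl⟩
  by_cases hk : finrank ℝ E < p + q
  · rw [cform_eq_zero_of_finrank_lt hk α]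
    exact Submodule.zero_mem _
  · obtain ⟨m, hm⟩ : ∃ m, (p + q) + m = finrank ℝ E := ⟨finrank ℝ E - (p + q), by omega⟩
    obtain ⟨g, o, hg, ho⟩ := exists_isKaehler_and_isSmoothForm_riemannianVolumeForm (E := E) (M := M)
    exact mem_dolbeaultExactForms_of_mem_cexactSmoothForms_of_isKaehler g o hg hm hαc hαt hex ho

/-- **(I) On a compact Kähler manifold a `∂̄`-exact closed `(p,q)`-form is `d`-exact** (Voisin (2002),
Lemma 6.18: injectivity of `K^{p,q} → H^q(X, Ω^p)`). [cite: Voisin2002, §6.1.3 Lemma 6.18] -/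
theorem mem_cexactSmoothForms_of_mem_dolbeaultExactForms [IsManifold 𝓘(ℂ, E) ω M] [CompactSpace M]
    [T2Space M] [IsKaehlerManifold E M] (p q : ℕ) (α : MForm 𝓘(ℝ, E) M ℂ (p + q))
    (hαc : α ∈ cclosedSmoothForms E M (p + q)) (hαt : IsOfType p q α)
    (hdex : α ∈ dolbeaultExactForms E M p q) : α ∈ cexactSmoothForms E M (p + q) := by
  haveI : Fact (finrank ℝ E = finrank ℝ E) := ⟨rfl⟩
  by_cases hk : finrank ℝ E < p + q
  · rw [cform_eq_zero_of_finrank_lt hk α]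
    exact Submodule.zero_mem _
  · obtain ⟨m, hm⟩ : ∃ m, (p + q) + m = finrank ℝ E := ⟨finrank ℝ E - (p + q), by omega⟩
    obtain ⟨g, o, hg, ho⟩ := exists_isKaehler_and_isSmoothForm_riemannianVolumeForm (E := E) (M := M)
    exact mem_cexactSmoothForms_of_mem_dolbeaultExactForms_of_isKaehler g o hg hm hαc hαt hdex ho

/-- **hodge.S07, comparison form — discharge of the named fact `exists_hodgePQ_equiv_dolbeaultCohomology`.**
On a compact Kähler manifold (compact Hausdorff complex manifold admitting a Kähler metric,
`IsKaehlerManifold E M`), for every `(p,q)` there is a `ℂ`-linear isomorphism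
`e : hodgePQ E M (p+q) p q ≃ₗ[ℂ] dolbeaultCohomology E M p q` which sends the de Rham class of every
closed smooth `(p,q)`-form to its Dolbeault class (Voisin (2002), Lemma 6.18: "`H^{p,q}(X)` is
canonically isomorphic to `H^q(X, Ω_Xᵖ)`"; Huybrechts (2005), Cor. 3.2.12). Proof:
`exists_hodgePQ_equiv_dolbeaultCohomology_of_classMap` fed (B), (I), (S).
[cite: Voisin2002, §6.1.3 Lemma 6.18] [cite: Huybrechts2005, Cor. 3.2.12] -/
theorem exists_hodgePQ_equiv_dolbeaultCohomology_holds :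
    exists_hodgePQ_equiv_dolbeaultCohomology (E := E) (M := M) := by
  refine exists_hodgePQ_equiv_dolbeaultCohomology_of_classMap (E := E) (M := M) ?_ ?_ ?_
  · intro _ _ _ _ p q α hαc hαt hex
    exact mem_dolbeaultExactForms_of_mem_cexactSmoothForms p q α hαc hαt hex
  · intro _ _ _ _ p q α hαc hαt hdex
    exact mem_cexactSmoothForms_of_mem_dolbeaultExactForms p q α hαc hαt hdex
  · intro _ _ _ _ p q c
    exact exists_isOfType_mem_cclosedSmoothForms_mk_eq p q c

/-- **`dim_ℂ H^{p,q} = h^{p,q}(M)` on a compact Kähler manifold**, instances as binders (Voisin (2002),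
Lemma 6.18 (p. 122); Huybrechts (2005), Cor. 3.2.12): the tree's `finrank_hodgePQ_eq_hodgeNumber` fed
the discharge. [cite: Voisin2002, §6.1.3 Lemma 6.18] -/
theorem finrank_hodgePQ_eq_hodgeNumber_holds [IsManifold 𝓘(ℂ, E) ω M] [CompactSpace M] [T2Space M]
    [IsKaehlerManifold E M] (p q : ℕ) :
    finrank ℂ ↥(hodgePQ E M (p + q) p q) = hodgeNumber E M p q :=
  finrank_hodgePQ_eq_hodgeNumber exists_hodgePQ_equiv_dolbeaultCohomology_holds p q

end Discharge

end Literature.AlgebraicGeometry.Motives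

end
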